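import Summits.NavierStokesRegularity.NavierStokesRegularity.Theorems.SqueezeCycleRecurrentLiouvilleFarFieldRegularity
import Summits.NavierStokesRegularity.NavierStokesRegularity.Theorems.SqueezeCycleRecurrentLiouvilleFarFieldVorticityVanishes
import Summits.NavierStokesRegularity.NavierStokesRegularity.Theorems.SqueezeCycleRecurrentLiouvilleDarkProfilesTrivial
import HarnessLib

/-!
# Crux `RecurrentLiouville` (stmt-NavierStokesRegularity-1589), line `Sketch` — stub
# `stub_satDarkApexProfiles`: dark apex-class profiles are regular (ESS, packaged)

Theorems-only file (no definitions, no named facts).  The three landed pieces of the DARK branch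
of line `Sketch` composed into one statement over the crux's class: a suitable weak solution
`(w, q)` of Navier–Stokes (`ν = 1`, `f = 0`) on the backward slab `(-∞,0) × ℝ³` with weak gradient
`H`, Albritton–Barker `𝐈 < ⊤` and the APEX bound `‖w(t,x)‖ ≤ C'/(‖x‖ + √(−t))`, whose final-time
trace vanishes off some ball in the sense of distributions (`∫⟪w(t), φ⟫ → 0` as `t ↑ 0` for every
test field supported in `{‖x‖ > R}`), is REGULAR at the space–time origin.

Proof (Escauriaza–Seregin–Šverák 2003, §3 for the apex class):
* D1 `satFR_representative` (`…FarFieldRegularity.lean`): on `(-1,0) × {‖x‖ > R}`,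
  `R = max R_d 1 + 1`, the field has a smooth far-field representative `U` with uniform bounds on
  `D_xⁿU`, `n ≤ 3` (Seregin–Šverák quantitative higher regularity on unit backward cylinders, the
  pressure made mean-free through the `D`-term of `𝐈`), which solves the equations in `𝒟'` there
  with the original pressure;
* D2 `stub_satFarFieldVorticityVanishes` (`…FarFieldVorticityVanishes.lean`): darkness off the
  ball and half-space backward uniqueness make `U` irrotational on `{‖x‖ > R + 2}`;
* D3 `stub_satDarkProfilesTrivial` (`…DarkProfilesTrivial.lean`): interior unique continuation for
  the classical interior representative, the curl-free/divergence-free Liouville theorem and the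
  apex bound give `w = 0` a.e. on `(-1,0) × ℝ³`, so the origin is regular.

## References

* L. Escauriaza, G. Seregin, V. Šverák, Russ. Math. Surveys 58 (2003) 211–250, §3, Thms. 4.1,
  5.1. [EscauriazaSereginSverak2003]
* D. Albritton, T. Barker, J. Math. Fluid Mech. 21 (2019) = arXiv:1811.00502, §1, Thm. 1.1.
  [AlbrittonBarker2019]
-/

noncomputable section

-- the sub-problem namespace repeats the summit name (D-0017 layout `Summit.<S>.<P>.Theorems`)
set_option linter.dupNamespace false

namespace Summit.NavierStokesRegularity.NavierStokesRegularity.Theorems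

open MeasureTheory Set Function Filter Topology TopologicalSpace Metric
open Literature.Analysis.FluidPDE
open scoped NNReal ENNReal RealInnerProductSpace ContDiff

/-- **Dark apex-class profiles are regular** (Escauriaza–Seregin–Šverák for the Albritton–Barker
class with the apex bound).  A suitable weak solution `(w, q)` on `(-∞,0) × ℝ³` with weak gradient
`H`, `𝐈 < ⊤` and `‖w(t,x)‖ ≤ C'/(‖x‖ + √(−t))`, whose final-time trace vanishes off some ball in
`𝒟'`, is regular at the origin: the smooth far-field representative of D1 (`satFR_representative`)
on `(-1,0) × {‖x‖ > R}`, `R = max R_d 1 + 1`, solves the equations in `𝒟'` with the original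
pressure; D2 makes it irrotational on `{‖x‖ > R + 2} ⊇ {x₂ > R + 2}`; D3 concludes.
[cite: EscauriazaSereginSverak2003, §3 with Thms. 4.1 and 5.1] -/
theorem stub_satDarkApexProfiles :
    ∀ (w : ℝ → EuclideanSpace ℝ (Fin 3) → EuclideanSpace ℝ (Fin 3))
      (q : ℝ → EuclideanSpace ℝ (Fin 3) → ℝ)
      (H : ℝ → EuclideanSpace ℝ (Fin 3) → EuclideanSpace ℝ (Fin 3) →L[ℝ] EuclideanSpace ℝ (Fin 3)) (C' : ℝ),
      IsSuitableWeakSolutionOn (slab (EuclideanSpace ℝ (Fin 3)) (Iio 0) isOpen_Iio) 1 0 w q →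
      HasWeakSpatialGradientOn (slab (EuclideanSpace ℝ (Fin 3)) (Iio 0) isOpen_Iio) w H →
      typeIBound (Iio (0 : ℝ) ×ˢ univ) w q H < ⊤ → HasTypeIDecay C' w →
      (∃ R : ℝ, ∀ φ : EuclideanSpace ℝ (Fin 3) → EuclideanSpace ℝ (Fin 3),
        Literature.Analysis.FunctionSpaces.IsTestFunctionOn (⊤ : Opens (EuclideanSpace ℝ (Fin 3))) φ →
        tsupport φ ⊆ (closedBall (0 : EuclideanSpace ℝ (Fin 3)) R)ᶜ →
        Tendsto (fun t => ∫ x, ⟪w t x, φ x⟫) (𝓝[<] (0 : ℝ)) (𝓝 0)) →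
      ¬ IsBackwardSingularPoint w 0 := by
  intro w q H C' hsw' hwg' hI' hdec' hdark
  -- glue adapted from the D2 worker's scratch `D2_glue_test.lean`
  obtain ⟨Rd, hRd⟩ := hdark
  have hC0 : 0 ≤ C' := by
    have h := hdec' (-1) (by norm_num) 0
    rw [norm_zero, zero_add, neg_neg, Real.sqrt_one, div_one] at h
    exact (norm_nonneg _).trans h
  set R : ℝ := max Rd 1 + 1 with hRdef
  have hR1 : (1 : ℝ) ≤ max Rd 1 := le_max_right _ _
  have hR0 : 0 ≤ R := by rw [hRdef]; linarith
  have hS : IsOpen ((closedBall (0 : EuclideanSpace ℝ (Fin 3)) R)ᶜ) := isClosed_closedBall.isOpen_compl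
  obtain ⟨K, U, hae, hUc, hCD, hjc, hbdK⟩ :=
    satFR_representative hsw' hI' hdec' hC0 hR1 (R := R) (by rw [hRdef]; linarith)
  have hle : (⟨Ioo (-1 : ℝ) 0 ×ˢ (closedBall (0 : EuclideanSpace ℝ (Fin 3)) R)ᶜ, isOpen_Ioo.prod hS⟩ :
      Opens (ℝ × EuclideanSpace ℝ (Fin 3))) ≤ slab (EuclideanSpace ℝ (Fin 3)) (Iio 0) isOpen_Iio :=
    fun z hz => mem_slab.2 hz.1.2
  have hsolU : IsDistributionalNSSolutionOn
      ⟨Ioo (-1 : ℝ) 0 ×ˢ (closedBall (0 : EuclideanSpace ℝ (Fin 3)) R)ᶜ, isOpen_Ioo.prod hS⟩ 1 0 U q :=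
    (hsw'.distributional.of_le hle).congr_ae hae.symm (ae_of_all _ fun _ => rfl)
  have hdarkR : ∀ φ : EuclideanSpace ℝ (Fin 3) → EuclideanSpace ℝ (Fin 3),
      Literature.Analysis.FunctionSpaces.IsTestFunctionOn (⊤ : Opens (EuclideanSpace ℝ (Fin 3))) φ →
      tsupport φ ⊆ (closedBall (0 : EuclideanSpace ℝ (Fin 3)) R)ᶜ →
      Tendsto (fun t => ∫ x, ⟪w t x, φ x⟫) (𝓝[<] (0 : ℝ)) (𝓝 0) := fun φ hφ hφR =>
    hRd φ hφ (hφR.trans (compl_subset_compl.2 (closedBall_subset_closedBall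
      (by rw [hRdef]; linarith [le_max_left Rd 1]))))
  have hcurl := stub_satFarFieldVorticityVanishes w U q R K hR0 hae hsolU hCD (fun n _ => hjc n)
    hbdK hdarkR
  -- the half-space `{x₂ > R + 2}` lies in `{‖x‖ > R + 2} ⊆ {‖x‖ > R}`
  have hx2 : ∀ x : EuclideanSpace ℝ (Fin 3), R + 2 < x 2 → R + 2 < ‖x‖ := fun x hx =>
    lt_of_lt_of_le hx ((le_abs_self _).trans (by simpa using PiLp.norm_apply_le x 2))
  have hsub : {x : EuclideanSpace ℝ (Fin 3) | R + 2 < x 2} ⊆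
      (closedBall (0 : EuclideanSpace ℝ (Fin 3)) R)ᶜ := fun x hx => by
    rw [mem_compl_iff, mem_closedBall, dist_zero_right, not_le]
    linarith [hx2 x hx]
  exact stub_satDarkProfilesTrivial w q H C' hsw' hwg' hI' hdec'
    ⟨R + 2, U, hUc.mono (prod_mono Subset.rfl hsub),
      ae_restrict_of_ae_restrict_of_subset (prod_mono Subset.rfl hsub) hae,
      fun t ht x hx => ((hCD (t, x) ⟨ht, hsub hx⟩).of_le (by norm_cast)).contDiffWithinAt,
      fun t ht x hx => hcurl t ht x (hx2 x hx)⟩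

end Summit.NavierStokesRegularity.NavierStokesRegularity.Theorems

end
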